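import Summits.HubbardSuperconductivity.HubbardSuperconductivity.Theorems.AnisotropyChordFerroSideChordFour
import Summits.HubbardSuperconductivity.HubbardSuperconductivity.Theorems.AnisotropyChordChordXYFourFar

/-!
# Route `AnisotropyChord`, crux `FerroSideChord` (stmt-HubbardSuperconductivity-19089), line
# `fm-monotone-anchor` (registered skeleton, stubs `stub_monotoneFM` / `stub_klsAnchor` /
# `stub_fmEndChord`): the slices of the three stubs that the tree proves today

Notation: `H_M(Δ) = xxzHamiltonian 1 (torusGraph 2 M) (-1) Δ` (`= hcbHamiltonian M Δ`), sector
`S^z_tot = 0`, `Λ(ψ) = Re⟨ψ, S⁺_tot S⁻_tot ψ⟩`, `S(S+1) = (M²/2)(M²/2+1)`.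

The three registered stubs are OPEN as stated (quantum Griffiths-II monotonicity in the Ising
coupling for three spin directions; the sharp reflection-positivity-free anchor `Λ_M(0) ≥ 0.7·S(S+1)`
at every even `M ≥ 4`; the FM-end chord on `[2/5, 1]` at every even `M ≥ 4`).  What holds now:

* `sectorGS_lambda_eq`, `monotoneFM_diag` — the DIAGONAL slice `Δ₁ = Δ₂` of `stub_monotoneFM`
  (every `L`, every sector): two normalised sector ground states of the same `H_L(Δ)` have the same
  `Λ` (Perron uniqueness up to a phase, tree `Stiffness.lambda_eq_lowerNormSq_of_sectorGround`);
* `lambda_four_zero_ge`, `klsAnchor_four` — the slice `M = 4` of `stub_klsAnchor`, with room: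
  `Λ_4(0) ≥ 133/2 = 0.92·S(S+1) ≥ (7/10)·S(S+1)` (`S(S+1) = 72`; kernel-certified KLS-point
  constant `FourTorus.lambda0_bounds` of the `4 × 4` torus);
* `fmEndChord_four` — the slice `M = 4` of `stub_fmEndChord` (`FourTorus.ferroSideChord_four`,
  which covers all of `[0,1]`).

No definition is introduced.
-/

set_option linter.dupNamespace false

noncomputable section

open Matrix Complex Finset
open Literature.MathematicalPhysics.QuantumLattice hiding torusPhase torusNorm
open Literature.Probability.LatticeModels
open Summit.HubbardSuperconductivity.HubbardSuperconductivity.Theorems.AnisotropyChord.InsertionEntropy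
open Summit.HubbardSuperconductivity.HubbardSuperconductivity.Theorems.AnisotropyChord.Stiffness
open Summit.HubbardSuperconductivity.HubbardSuperconductivity.Theorems.AnisotropyChord.FourTorus

namespace Summit.HubbardSuperconductivity.HubbardSuperconductivity.Theorems.AnisotropyChord.FerroSide

/-! ### The diagonal slice of `stub_monotoneFM` -/

/-- The `S^z`-sector containing a unit vector is non-trivial. [folklore] -/
theorem spinZSector_ne_bot_of_unit' (L : ℕ) [NeZero L] {M : ℝ}
    {ψ : TensorIndex (TorusSite 2 L) 2 → ℂ}
    (hψK : ψ ∈ spinZSector (Λ := TorusSite 2 L) 1 M) (hψ1 : star ψ ⬝ᵥ ψ = 1) :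
    spinZSector (Λ := TorusSite 2 L) 1 M ≠ ⊥ := by
  intro hbot
  rw [hbot, Submodule.mem_bot] at hψK
  rw [hψK, dotProduct_zero] at hψ1
  exact zero_ne_one hψ1

/-- **The order parameter `Λ` is a function of `Δ` alone on sector ground states — diagonal slice
`Δ₁ = Δ₂` of the registered stub `stub_monotoneFM` (line `fm-monotone-anchor` of crux
`FerroSideChord`):** two normalised sector-`M` ground states of the SAME `H_L(Δ)` have the same
`Re⟨ψ, S⁺_tot S⁻_tot ψ⟩` (Perron uniqueness up to a phase). [folklore] -/
theorem sectorGS_lambda_eq (L : ℕ) [NeZero L] {Δ M : ℝ} {ψ₁ ψ₂ : TensorIndex (TorusSite 2 L) 2 → ℂ}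
    (h₁K : ψ₁ ∈ spinZSector (Λ := TorusSite 2 L) 1 M) (h₁1 : star ψ₁ ⬝ᵥ ψ₁ = 1)
    (h₁H : hcbHamiltonian L Δ *ᵥ ψ₁ = ((lowestEnergyInSector 1 (hcbHamiltonian L Δ) M : ℝ) : ℂ) • ψ₁)
    (h₂K : ψ₂ ∈ spinZSector (Λ := TorusSite 2 L) 1 M) (h₂1 : star ψ₂ ⬝ᵥ ψ₂ = 1)
    (h₂H : hcbHamiltonian L Δ *ᵥ ψ₂ = ((lowestEnergyInSector 1 (hcbHamiltonian L Δ) M : ℝ) : ℂ) • ψ₂) :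
    (star ψ₁ ⬝ᵥ (((∑ x : TorusSite 2 L, onSite x (spinRaise 1)) *
        (∑ y : TorusSite 2 L, onSite y (spinLower 1)) : Op (TorusSite 2 L) 2) *ᵥ ψ₁)).re =
      (star ψ₂ ⬝ᵥ (((∑ x : TorusSite 2 L, onSite x (spinRaise 1)) *
        (∑ y : TorusSite 2 L, onSite y (spinLower 1)) : Op (TorusSite 2 L) 2) *ᵥ ψ₂)).re := by
  obtain ⟨a, ha⟩ := exists_perronAmplitude L Δ M (spinZSector_ne_bot_of_unit' L h₁K h₁1)
  rw [lambda_eq_lowerNormSq_of_sectorGround Δ M a ha ψ₁ h₁K h₁1 h₁H,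
    lambda_eq_lowerNormSq_of_sectorGround Δ M a ha ψ₂ h₂K h₂1 h₂H]

/-- **Diagonal slice `Δ₁ = Δ₂` of the registered stub `stub_monotoneFM`** (line `fm-monotone-anchor`
of crux `FerroSideChord`, stmt-19089), in the stub's own binder shape: for even `M ≥ 4`,
`0 ≤ Δ ≤ 1` and two normalised `S^z_tot = 0` sector ground states `ψ₁`, `ψ₂` of the same `H_M(Δ)`,
`Λ(ψ₁) ≤ Λ(ψ₂)` (indeed `=`).  The off-diagonal content `Δ₁ < Δ₂` (Griffiths-II for the quantum
XXZ model in three spin directions) remains open. [folklore] -/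
theorem monotoneFM_diag :
    ∀ (M : ℕ) [NeZero M], Even M → 4 ≤ M → ∀ (Δ : ℝ), 0 ≤ Δ → Δ ≤ 1 →
      ∀ (ψ₁ ψ₂ : TensorIndex (TorusSite 2 M) 2 → ℂ),
      ψ₁ ∈ spinZSector (Λ := TorusSite 2 M) 1 0 → star ψ₁ ⬝ᵥ ψ₁ = 1 →
      Matrix.mulVec (xxzHamiltonian 1 (torusGraph 2 M) (-1) Δ) ψ₁ =
        ((lowestEnergyInSector 1 (xxzHamiltonian 1 (torusGraph 2 M) (-1) Δ) 0 : ℝ) : ℂ) • ψ₁ →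
      ψ₂ ∈ spinZSector (Λ := TorusSite 2 M) 1 0 → star ψ₂ ⬝ᵥ ψ₂ = 1 →
      Matrix.mulVec (xxzHamiltonian 1 (torusGraph 2 M) (-1) Δ) ψ₂ =
        ((lowestEnergyInSector 1 (xxzHamiltonian 1 (torusGraph 2 M) (-1) Δ) 0 : ℝ) : ℂ) • ψ₂ →
      (star ψ₁ ⬝ᵥ Matrix.mulVec ((∑ x : TorusSite 2 M, onSite x (spinRaise 1)) *
          (∑ y : TorusSite 2 M, onSite y (spinLower 1))) ψ₁).re ≤
        (star ψ₂ ⬝ᵥ Matrix.mulVec ((∑ x : TorusSite 2 M, onSite x (spinRaise 1)) *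
          (∑ y : TorusSite 2 M, onSite y (spinLower 1))) ψ₂).re := by
  intro M _ _hE _h4 Δ _h0 _h1 ψ₁ ψ₂ h₁K h₁1 h₁H h₂K h₂1 h₂H
  exact le_of_eq (sectorGS_lambda_eq M h₁K h₁1 h₁H h₂K h₂1 h₂H)

/-! ### The `M = 4` slices of `stub_klsAnchor` and `stub_fmEndChord` -/

/-- **The KLS-point order parameter of the `4 × 4` torus:** every normalised `S^z_tot = 0` sector
ground state `ψ₀` of `H_4(0)` has `133/2 ≤ Re⟨ψ₀, S⁺_tot S⁻_tot ψ₀⟩` (kernel-certified,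
`FourTorus.lambda0_bounds`; exact value `≈ 68.0`). [folklore] -/
theorem lambda_four_zero_ge (ψ₀ : TensorIndex (TorusSite 2 4) 2 → ℂ)
    (hK : ψ₀ ∈ spinZSector (Λ := TorusSite 2 4) 1 0) (h1 : star ψ₀ ⬝ᵥ ψ₀ = 1)
    (hH : Matrix.mulVec (xxzHamiltonian 1 (torusGraph 2 4) (-1) 0) ψ₀ =
      ((lowestEnergyInSector 1 (xxzHamiltonian 1 (torusGraph 2 4) (-1) 0) 0 : ℝ) : ℂ) • ψ₀) :
    133 / 2 ≤ (star ψ₀ ⬝ᵥ Matrix.mulVec ((∑ x : TorusSite 2 4, onSite x (spinRaise 1)) *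
        (∑ y : TorusSite 2 4, onSite y (spinLower 1))) ψ₀).re := by
  obtain ⟨a₀, ha₀⟩ := exists_perronAmplitude 4 0 0 (spinZSector_ne_bot_of_unit' 4 hK h1)
  rw [lambda_eq_lowerNormSq_of_sectorGround 0 0 a₀ ha₀ ψ₀ hK h1 hH]
  exact (lambda0_bounds ha₀).1

/-- **Slice `M = 4` of the registered stub `stub_klsAnchor`** (line `fm-monotone-anchor` of crux
`FerroSideChord`, stmt-19089): every normalised `S^z_tot = 0` sector ground state `ψ₀` of `H_4(0)`
has `(7/10)·((4²/2)(4²/2+1)) ≤ Re⟨ψ₀, S⁺_tot S⁻_tot ψ₀⟩` (`50.4 ≤ 66.5 ≤ Λ_4(0)`).  The stub asks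
this for every even `M ≥ 4` (open: a sharp reflection-positivity-free LRO constant). [folklore] -/
theorem klsAnchor_four (ψ₀ : TensorIndex (TorusSite 2 4) 2 → ℂ)
    (hK : ψ₀ ∈ spinZSector (Λ := TorusSite 2 4) 1 0) (h1 : star ψ₀ ⬝ᵥ ψ₀ = 1)
    (hH : Matrix.mulVec (xxzHamiltonian 1 (torusGraph 2 4) (-1) 0) ψ₀ =
      ((lowestEnergyInSector 1 (xxzHamiltonian 1 (torusGraph 2 4) (-1) 0) 0 : ℝ) : ℂ) • ψ₀) :
    7 / 10 * (((4 : ℕ) : ℝ) ^ 2 / 2 * (((4 : ℕ) : ℝ) ^ 2 / 2 + 1)) ≤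
      (star ψ₀ ⬝ᵥ Matrix.mulVec ((∑ x : TorusSite 2 4, onSite x (spinRaise 1)) *
        (∑ y : TorusSite 2 4, onSite y (spinLower 1))) ψ₀).re := by
  have h := lambda_four_zero_ge ψ₀ hK h1 hH
  push_cast
  linarith

/-- **Slice `M = 4` of the registered stub `stub_fmEndChord`** (line `fm-monotone-anchor` of crux
`FerroSideChord`, stmt-19089): for `Δ ∈ [2/5, 1]` every normalised `S^z_tot = 0` sector ground state
`ψ` of `H_4(Δ)` has `((1+Δ)/2)·((4²/2)(4²/2+1)) ≤ Re⟨ψ, S⁺_tot S⁻_tot ψ⟩` (the kernel-certified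
`FourTorus.ferroSideChord_four` covers all of `[0,1]`).  The stub asks this for every even `M ≥ 4`
(open). [folklore] -/
theorem fmEndChord_four :
    ∀ Δ ∈ Set.Icc (2/5:ℝ) 1, ∀ (ψ : TensorIndex (TorusSite 2 4) 2 → ℂ),
      ψ ∈ spinZSector (Λ := TorusSite 2 4) 1 0 → star ψ ⬝ᵥ ψ = 1 →
      Matrix.mulVec (xxzHamiltonian 1 (torusGraph 2 4) (-1) Δ) ψ =
        ((lowestEnergyInSector 1 (xxzHamiltonian 1 (torusGraph 2 4) (-1) Δ) 0 : ℝ) : ℂ) • ψ →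
      (1 + Δ) / 2 * (((4 : ℕ) : ℝ) ^ 2 / 2 * (((4 : ℕ) : ℝ) ^ 2 / 2 + 1)) ≤
        (star ψ ⬝ᵥ Matrix.mulVec ((∑ x : TorusSite 2 4, onSite x (spinRaise 1)) *
          (∑ y : TorusSite 2 4, onSite y (spinLower 1))) ψ).re := by
  intro Δ hΔ ψ hK h1 hH
  exact ferroSideChord_four Δ ⟨by linarith [hΔ.1], hΔ.2⟩ ψ hK h1 hH

end Summit.HubbardSuperconductivity.HubbardSuperconductivity.Theorems.AnisotropyChord.FerroSide

end
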